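import Summits.PneNP.PneNP.Theorems.PhaseTwinsPolyDepthTwinsAboveAcPortLawLogs

/-!
# Route PhaseTwins, crux `PolyDepthTwinsAbove` (stmt-PneNP-2719), line `annealed-cover-twins`:
the pair point of the product profile (milestone M4/M5 of `stub_annealedPortLaw`, convexity part)

The variational input `CoverGap d lam pp pm` of the line asserts a power-law gap of the annealed
exponent `coverLambda` around the product profile `ν⁺ = (p⁺(1-p⁻), (1-p⁺)p⁻, p⁺p⁻)` with SOME
admissible pair point `(us, vs)`. Here we pin the pair point down: by the tangent inequality for
`x log x` (`xlogx_tangent`), the pair part `coverPsi (ν⁺, ·, ·)` is maximal at the explicit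
stationary point `u* = p⁺(1-p⁺-p⁻)`, `v* = (1-p⁺-p⁻)p⁻` (`coverPsi_le_pairPoint`: the linear terms
cancel exactly because `u*² = r*(ν₁₀-u*)`, `v*² = r*(ν₀₁-v*)`, `r* = (1-p⁺-p⁻)²`), so the gap
inequality evaluated at `(ν⁺, u*, v*)` forces `(us, vs) = (u*, v*)` (`coverGap_pairPoint`) and
`CoverGap` holds with the explicit pair point (`coverGap_explicit`) — the form consumed by the
localisation and the port-tilt computation of the annealed port law. [folklore]
-/

noncomputable section

open scoped Classical BigOperators

namespace Summit.PneNP.PneNP.Cruxes.PolyDepthTwinsAbove.AnnealedCoverTwins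

open Finset

set_option linter.dupNamespace false

/-! ## The tangent inequality for `x log x` -/

/-- **Convexity of `x log x`, tangent form**: `x₀ log x₀ + (log x₀ + 1)(x - x₀) ≤ x log x` for
`x ≥ 0`, `x₀ > 0`. -/
theorem xlogx_tangent {x x₀ : ℝ} (hx : 0 ≤ x) (hx₀ : 0 < x₀) :
    xlogx x₀ + (Real.log x₀ + 1) * (x - x₀) ≤ xlogx x := by
  unfold xlogx
  rcases eq_or_lt_of_le hx with rfl | hxpos
  · simp only [zero_mul, zero_sub, mul_neg]
    linarith
  · have h := Real.one_sub_inv_le_log_of_pos (div_pos hxpos hx₀)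
    rw [inv_div, Real.log_div hxpos.ne' hx₀.ne'] at h
    have h2 : x * (1 - x₀ / x) ≤ x * (Real.log x - Real.log x₀) := mul_le_mul_of_nonneg_left h hxpos.le
    have h3 : x * (1 - x₀ / x) = x - x₀ := by field_simp
    rw [h3] at h2
    nlinarith

/-! ## The pair point of the product profile -/

/-- **The pair part is maximal at the stationary pair point.** At the product profile
`(ν₀₀, ν₁₀, ν₀₁, ν₁₁) = ((1-p⁺)(1-p⁻), p⁺(1-p⁻), (1-p⁺)p⁻, p⁺p⁻)`, for every admissible `(u, v)`:
`coverPsi ν⁺ u v ≤ coverPsi ν⁺ u* v*` with `u* = p⁺(1-p⁺-p⁻)`, `v* = (1-p⁺-p⁻)p⁻`. -/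
theorem coverPsi_le_pairPoint {pp pm : ℝ} (hpm : 0 < pm) (hpp : 0 < pp) (hsum : pp + pm < 1) {u v : ℝ}
    (hu0 : 0 ≤ u) (hu1 : u ≤ pp * (1 - pm)) (hv0 : 0 ≤ v) (hv1 : v ≤ (1 - pp) * pm)
    (hr : u + v + pp * pm ≤ (1 - pp) * (1 - pm)) :
    coverPsi ((1 - pp) * (1 - pm)) (pp * (1 - pm)) ((1 - pp) * pm) (pp * pm) u v ≤
      coverPsi ((1 - pp) * (1 - pm)) (pp * (1 - pm)) ((1 - pp) * pm) (pp * pm) (pp * (1 - pp - pm))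
        ((1 - pp - pm) * pm) := by
  set g := 1 - pp - pm with hg
  have hgpos : 0 < g := by rw [hg]; linarith
  rw [coverPsi_eq, coverPsi_eq]
  -- the five tangent inequalities at the starred values
  have t1 := xlogx_tangent hu0 (mul_pos hpp hgpos)            -- at `u* = pp g`
  have t2 := xlogx_tangent hv0 (mul_pos hgpos hpm)            -- at `v* = g pm`
  have t3 := xlogx_tangent (x := pp * (1 - pm) - u) (x₀ := pp ^ 2) (by linarith) (by positivity)
  have t4 := xlogx_tangent (x := (1 - pp) * pm - v) (x₀ := pm ^ 2) (by linarith) (by positivity)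
  have t5 := xlogx_tangent (x := (1 - pp) * (1 - pm) - u - v - pp * pm) (x₀ := g ^ 2) (by linarith)
    (by positivity)
  -- the starred remainders
  have e3 : pp * (1 - pm) - pp * g = pp ^ 2 := by rw [hg]; ring
  have e4 : (1 - pp) * pm - g * pm = pm ^ 2 := by rw [hg]; ring
  have e5 : (1 - pp) * (1 - pm) - pp * g - g * pm - pp * pm = g ^ 2 := by rw [hg]; ring
  rw [show (1 - pp - pm) * pm = g * pm by rw [hg], e3, e4, e5]
  -- the logarithms of the starred values
  have l1 : Real.log (pp * g) = Real.log pp + Real.log g := Real.log_mul hpp.ne' hgpos.ne'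
  have l2 : Real.log (g * pm) = Real.log g + Real.log pm := Real.log_mul hgpos.ne' hpm.ne'
  have l3 : Real.log (pp ^ 2) = 2 * Real.log pp := by rw [Real.log_pow]; norm_num
  have l4 : Real.log (pm ^ 2) = 2 * Real.log pm := by rw [Real.log_pow]; norm_num
  have l5 : Real.log (g ^ 2) = 2 * Real.log g := by rw [Real.log_pow]; norm_num
  rw [l1] at t1; rw [l2] at t2; rw [l3] at t3; rw [l4] at t4; rw [l5] at t5
  nlinarith [t1, t2, t3, t4, t5]

/-- The explicit pair point is admissible. -/
theorem adm_pairPoint {pp pm : ℝ} (hpm : 0 < pm) (hpp : 0 < pp) (hsum : pp + pm < 1) :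
    Adm (pp * (1 - pm)) ((1 - pp) * pm) (pp * pm) (pp * (1 - pp - pm)) ((1 - pp - pm) * pm) := by
  have hg : 0 < 1 - pp - pm := by linarith
  refine ⟨by nlinarith, by nlinarith, by nlinarith, by nlinarith, by nlinarith, by nlinarith, by nlinarith,
    by nlinarith, by nlinarith⟩

/-- **The pair point of `CoverGap` is the stationary one.** If `CoverGap d lam pp pm` holds with
pair point `(us, vs)`, then `(us, vs) = (p⁺(1-p⁺-p⁻), (1-p⁺-p⁻)p⁻)`. -/
theorem coverGap_pairPoint {d : ℕ} {lam pp pm : ℝ} (hpm : 0 < pm) (hlt : pm < pp) (hsum : pp + pm < 1)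
    {us vs : ℝ} (hadm : Adm (pp * (1 - pm)) ((1 - pp) * pm) (pp * pm) us vs) {ℓ : ℕ} {C : ℝ} (hC : 0 < C)
    (hgap : ∀ ν₁₀ ν₀₁ ν₁₁ u v : ℝ, Adm ν₁₀ ν₀₁ ν₁₁ u v →
      coverLambda d lam (1 - ν₁₀ - ν₀₁ - ν₁₁) ν₁₀ ν₀₁ ν₁₁ u v +
          C * min (profDist pp pm us vs ν₁₀ ν₀₁ ν₁₁ u v) (profDist pm pp vs us ν₁₀ ν₀₁ ν₁₁ u v) ^ ℓ ≤
        coverLambda d lam ((1 - pp) * (1 - pm)) (pp * (1 - pm)) ((1 - pp) * pm) (pp * pm) us vs) :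
    us = pp * (1 - pp - pm) ∧ vs = (1 - pp - pm) * pm := by
  have hpp : 0 < pp := by linarith
  set u0 := pp * (1 - pp - pm) with hu0
  set v0 := (1 - pp - pm) * pm with hv0
  have h1 := hgap (pp * (1 - pm)) ((1 - pp) * pm) (pp * pm) u0 v0 (adm_pairPoint hpm hpp hsum)
  have e00 : 1 - pp * (1 - pm) - (1 - pp) * pm - pp * pm = (1 - pp) * (1 - pm) := by ring
  rw [e00] at h1
  -- the pair part at `(us, vs)` is at most the pair part at the stationary point
  obtain ⟨-, -, -, -, hus0, hus1, hvs0, hvs1, hr⟩ := hadm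
  have h2 := coverPsi_le_pairPoint hpm hpp hsum hus0 hus1 hvs0 hvs1 (by linarith)
  have h3 : coverLambda d lam ((1 - pp) * (1 - pm)) (pp * (1 - pm)) ((1 - pp) * pm) (pp * pm) us vs ≤
      coverLambda d lam ((1 - pp) * (1 - pm)) (pp * (1 - pm)) ((1 - pp) * pm) (pp * pm) u0 v0 := by
    unfold coverLambda
    have hd : (0 : ℝ) ≤ d := Nat.cast_nonneg d
    nlinarith [h2, hd]
  -- hence the gap term vanishes
  have hmin : min (profDist pp pm us vs (pp * (1 - pm)) ((1 - pp) * pm) (pp * pm) u0 v0)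
      (profDist pm pp vs us (pp * (1 - pm)) ((1 - pp) * pm) (pp * pm) u0 v0) ^ ℓ ≤ 0 := by
    by_contra hcon
    have := mul_pos hC (not_le.1 hcon)
    linarith
  have hnn : 0 ≤ min (profDist pp pm us vs (pp * (1 - pm)) ((1 - pp) * pm) (pp * pm) u0 v0)
      (profDist pm pp vs us (pp * (1 - pm)) ((1 - pp) * pm) (pp * pm) u0 v0) := by
    unfold profDist
    exact le_min (le_max_of_le_left (le_max_of_le_left (abs_nonneg _)))
      (le_max_of_le_left (le_max_of_le_left (abs_nonneg _)))
  have hzero : min (profDist pp pm us vs (pp * (1 - pm)) ((1 - pp) * pm) (pp * pm) u0 v0)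
      (profDist pm pp vs us (pp * (1 - pm)) ((1 - pp) * pm) (pp * pm) u0 v0) = 0 := by
    rcases Nat.eq_zero_or_pos ℓ with hl | hl
    · rw [hl, pow_zero] at hmin; linarith
    · exact le_antisymm (by
        by_contra hcon
        exact absurd (pow_pos (not_le.1 hcon) ℓ) (not_lt.2 hmin)) hnn
  -- the swapped distance is positive (`p⁺ ≠ p⁻`), so the direct distance vanishes
  have hswap : 0 < profDist pm pp vs us (pp * (1 - pm)) ((1 - pp) * pm) (pp * pm) u0 v0 := by
    unfold profDist
    refine lt_max_of_lt_left (lt_max_of_lt_left ?_)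
    rw [abs_pos]
    intro h
    have : pp - pm = 0 := by linarith
    linarith
  have hdirect : profDist pp pm us vs (pp * (1 - pm)) ((1 - pp) * pm) (pp * pm) u0 v0 = 0 := by
    rcases min_choice (profDist pp pm us vs (pp * (1 - pm)) ((1 - pp) * pm) (pp * pm) u0 v0)
      (profDist pm pp vs us (pp * (1 - pm)) ((1 - pp) * pm) (pp * pm) u0 v0) with h | h
    · rw [← h]; exact hzero
    · rw [h] at hzero; linarith
  unfold profDist at hdirect
  have hu : |u0 - us| ≤ 0 := by
    rw [← hdirect]; exact le_max_of_le_right (le_max_of_le_right (le_max_left _ _))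
  have hv : |v0 - vs| ≤ 0 := by
    rw [← hdirect]; exact le_max_of_le_right (le_max_of_le_right (le_max_right _ _))
  have hu' : u0 - us = 0 := abs_nonpos_iff.1 hu
  have hv' : v0 - vs = 0 := abs_nonpos_iff.1 hv
  exact ⟨by linarith, by linarith⟩

/-- **`CoverGap` with the explicit pair point.** -/
theorem coverGap_explicit {d : ℕ} {lam pp pm : ℝ} (hpm : 0 < pm) (hlt : pm < pp) (hsum : pp + pm < 1)
    (hgap : CoverGap d lam pp pm) :
    ∃ (ℓ : ℕ) (C : ℝ), 0 < C ∧ ∀ ν₁₀ ν₀₁ ν₁₁ u v : ℝ, Adm ν₁₀ ν₀₁ ν₁₁ u v →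
      coverLambda d lam (1 - ν₁₀ - ν₀₁ - ν₁₁) ν₁₀ ν₀₁ ν₁₁ u v +
          C * min (profDist pp pm (pp * (1 - pp - pm)) ((1 - pp - pm) * pm) ν₁₀ ν₀₁ ν₁₁ u v)
            (profDist pm pp ((1 - pp - pm) * pm) (pp * (1 - pp - pm)) ν₁₀ ν₀₁ ν₁₁ u v) ^ ℓ ≤
        coverLambda d lam ((1 - pp) * (1 - pm)) (pp * (1 - pm)) ((1 - pp) * pm) (pp * pm)
          (pp * (1 - pp - pm)) ((1 - pp - pm) * pm) := by
  obtain ⟨us, vs, hadm, ℓ, C, hC, h⟩ := hgap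
  obtain ⟨rfl, rfl⟩ := coverGap_pairPoint hpm hlt hsum hadm hC h
  exact ⟨ℓ, C, hC, h⟩

end Summit.PneNP.PneNP.Cruxes.PolyDepthTwinsAbove.AnnealedCoverTwins
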